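import Literature.Computability.Cryptography.SchemesSKEProofs
import Literature.Computability.Cryptography.SchemesProofs
import Literature.Computability.Cryptography.LamportOTSSecurity
import Literature.Computability.Cryptography.OneTimeSignaturesFromOWF
import HarnessLib

/-!
# Private-key encryption ⇒ one-way functions ⇒ signatures: the corollary
# `secureSignaturesExist_of_secureSKEExist` reduced to Rompel's theorem

Sibling proof file of `Schemes.lean` (D-0014), joining two developments that must not import each
other's umbrella: `SchemesSKEProofs.lean` (the discharge `OWFExist_of_secureSKEExist_holds :
SecureSKEExist → OWFExist` of **crypto-foundations.S13**, private-key case — Impagliazzo–Luby 1989,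
Thm. 1, in Goldreich's rendering, FoC II §5.5 Exercise 2 with FoC I §3.8 Exercise 11) and
`SchemesProofs.lean` (the hypothesis-explicit assembly of S13/S23 and of Goldreich's Thm. 6.4.1).

* `secureSignaturesExist_of_secureSKEExist_of_OWF` — with Impagliazzo–Luby's half now a theorem, the
  corollary `secureSignaturesExist_of_secureSKEExist` (secure private-key encryption ⇒ EUF-CMA-secure
  signature schemes) depends on exactly ONE remaining named fact, `secureSignaturesExist_of_OWFExist`
  (Rompel 1990, Thm. 3 = Goldreich 2004, Thm. 6.4.1: one-way functions ⇒ secure signature schemes);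
  `…_of_S23` and `…_of_oneTimeSecure` are the same reduction through the packaged equivalence
  `secureSignaturesExist_iff_OWFExist` (hard direction only) and through Goldreich's printed assembly of
  Thm. 6.4.1 from its two one-time-signature halves (`secureSignaturesExist_of_OWFExist_of_oneTimeSecure`).
* `exists_isRestrictedOneTimeSecure_of_secureSKEExist` — the UNCONDITIONAL station reached so far on
  the printed route: secure private-key encryption ⇒ (one-way functions ⇒) secure `ℓ`-restricted one-time
  signature schemes for every nonzero polynomial `ℓ` (Lamport's Construction 6.4.4; Goldreich 2004,
  Cor. 6.4.6, `exists_isRestrictedOneTimeSecure_of_OWFExist` of `LamportOTSSecurity.lean`).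
* `exists_isOneTimeSecure_of_secureSKEExist_of` — under Rompel's theorem, private-key encryption yields
  secure (unrestricted) one-time signature schemes.
* `exists_isOneTimeSecure_of_secureSKEExist` — the NEXT UNCONDITIONAL station, now that one-way functions ⇒
  UOWHFs ⇒ one-time hash-and-sign is a theorem of the tree (`exists_isOneTimeSecure_of_OWFExist`,
  `OneTimeSignaturesFromOWF.lean`: Goldreich 2004, Thm. 6.4.29 with Thm. 6.4.32): secure private-key
  encryption ⇒ secure one-time signature schemes for documents of arbitrary length, outright.
* `secureSignaturesExist_of_secureSKEExist_of_thm649` — hence the corollary is reduced to Goldreich's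
  Thm. 6.4.9 alone (secure one-time signature schemes ⇒ secure memoryless signature schemes, authentication
  trees; `TreeSig*.lean` in progress).

No statement is changed and no named fact is introduced: every declaration below is a proved theorem.
The discharge `secureSignaturesExist_of_secureSKEExist_holds` itself is NOT here yet: in the tree's
uniform, stateless model it is `secureSignaturesExist_of_OWFExist_holds ∘ OWFExist_of_secureSKEExist_holds`
(equivalently `secureSignaturesExist_of_secureSKEExist_of_OWF secureSignaturesExist_of_OWFExist_holds`),
and of the first factor (one-way functions ⇒ UOWHFs ⇒ one-time hash-and-sign over Lamport's scheme ⇒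
authentication trees made memoryless with pseudorandom functions; Goldreich 2004, §6.4.1–6.4.3, Thms.
6.4.29, 6.4.32, 6.4.9, consuming also `PRGExist_iff_OWFExist` and `GGM1986_thm3`) the last step, Thm. 6.4.9
with its pseudorandom functions, is not yet proved in the tree.

## References

* R. Impagliazzo, M. Luby, *One-way functions are essential for complexity based cryptography*,
  FOCS 1989, Theorem 1.
* J. Rompel, *One-way functions are necessary and sufficient for secure signatures*, STOC 1990,
  Theorem 3 (uniform model).
* O. Goldreich, *Foundations of Cryptography II: Basic Applications*, CUP 2004, §5.5 Exercise 2;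
  Thm. 6.4.1 and §6.4.3.4 ("combining Theorems 6.4.29, 6.4.32, and 6.4.9, we establish Theorem
  6.4.1"); §6.4.1.2, Construction 6.4.4, Prop. 6.4.5, Cor. 6.4.6; Thm. 6.4.9, Thm. 6.4.29, Thm. 6.4.32.
* O. Goldreich, *Foundations of Cryptography I: Basic Tools*, CUP 2001, §3.8 Exercise 11.
-/

namespace Literature.Computability.Cryptography

open Polynomial

/-- **Reduction of the corollary to Rompel's theorem alone.** With Impagliazzo–Luby's half proved
(`OWFExist_of_secureSKEExist_holds`, `SchemesSKEProofs.lean`), secure private-key encryption ⇒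
EUF-CMA-secure signatures follows from the single named fact `secureSignaturesExist_of_OWFExist`
(one-way functions ⇒ secure signature schemes). [Impagliazzo–Luby 1989, Thm. 1; Rompel 1990, Thm. 3;
Goldreich 2004, Thm. 6.4.1] [cite: ImpagliazzoLuby1989, Thm. 1] -/
theorem secureSignaturesExist_of_secureSKEExist_of_OWF (h : secureSignaturesExist_of_OWFExist) :
    secureSignaturesExist_of_secureSKEExist :=
  secureSignaturesExist_of_secureSKEExist_of OWFExist_of_secureSKEExist_holds h

/-- The same reduction through the packaged equivalence **S23** (`secureSignaturesExist_iff_OWFExist`,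
of which only the hard direction is used; its easy direction is the theorem
`OWFExist_of_secureSignaturesExist_holds`). [Rompel 1990 (title theorem); Goldreich 2004, Thm. 6.4.1]
[cite: Rompel1990, Thm. 3] -/
theorem secureSignaturesExist_of_secureSKEExist_of_S23 (h : secureSignaturesExist_iff_OWFExist) :
    secureSignaturesExist_of_secureSKEExist :=
  secureSignaturesExist_of_secureSKEExist_of_OWF h.2

/-- The same reduction through **Goldreich's printed assembly of Thm. 6.4.1** from its two halves over
one-time signature schemes (`SignatureScheme.IsOneTimeSecure`, Goldreich 2004, Def. 6.4.2):
`h₁` = Thm. 6.4.29 with Thm. 6.4.32 (one-way functions ⇒ UOWHFs ⇒ secure one-time signature schemes),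
`h₂` = Thm. 6.4.9 (secure one-time signature schemes ⇒ secure memoryless signature schemes, by
authentication trees and pseudorandom functions). [Goldreich 2004, Thm. 6.4.1 and §6.4.3.4]
[cite: Goldreich2004, Thm. 6.4.1 and §6.4.3.4] -/
theorem secureSignaturesExist_of_secureSKEExist_of_oneTimeSecure
    (h₁ : OWFExist → ∃ S : SignatureScheme, S.IsOneTimeSecure)
    (h₂ : (∃ S : SignatureScheme, S.IsOneTimeSecure) → SecureSignaturesExist) :
    secureSignaturesExist_of_secureSKEExist :=
  secureSignaturesExist_of_secureSKEExist_of_OWF (secureSignaturesExist_of_OWFExist_of_oneTimeSecure h₁ h₂)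

/-- **The unconditional station: private-key encryption ⇒ Lamport one-time signatures.** If there is
an efficient, correct private-key encryption scheme with indistinguishable multiple encryptions, then
for every nonzero polynomial `ℓ` there is a secure `ℓ`-restricted one-time signature scheme
(`SignatureScheme.IsRestrictedOneTimeSecure`, Goldreich 2004, Def. 6.4.3): one-way functions exist by
Impagliazzo–Luby (`OWFExist_of_secureSKEExist_holds`), and Lamport's Construction 6.4.4 instantiated
with any one-way function is a secure `ℓ`-restricted one-time signature scheme (Prop. 6.4.5 /
Cor. 6.4.6, `exists_isRestrictedOneTimeSecure_of_OWFExist`). (`ℓ ≠ 0` is needed: for `ℓ(n) = 0` the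
empty document with the empty signature is a forgery.) [Impagliazzo–Luby 1989, Thm. 1; Goldreich 2004,
Cor. 6.4.6] [cite: Goldreich2004, Cor. 6.4.6] -/
theorem exists_isRestrictedOneTimeSecure_of_secureSKEExist (h : SecureSKEExist) (ℓ : Polynomial ℕ)
    (hℓ : ℓ ≠ 0) : ∃ S : SignatureScheme, S.IsRestrictedOneTimeSecure fun n => ℓ.eval n :=
  exists_isRestrictedOneTimeSecure_of_OWFExist (OWFExist_of_secureSKEExist_holds h) ℓ hℓ

/-- Under Rompel's theorem, private-key encryption already yields a secure *one-time* signature scheme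
for documents of arbitrary length (through one-way functions and
`SignatureScheme.IsEUFCMA.isOneTimeSecure`). [Goldreich 2004, Thm. 6.4.1 with §6.4.1 (remark after
Def. 6.4.1)] [cite: Goldreich2004, Thm. 6.4.1] -/
theorem exists_isOneTimeSecure_of_secureSKEExist_of (h : secureSignaturesExist_of_OWFExist)
    (hS : SecureSKEExist) : ∃ S : SignatureScheme, S.IsOneTimeSecure :=
  exists_isOneTimeSecure_of_OWFExist_of h (OWFExist_of_secureSKEExist_holds hS)

/-- **The next unconditional station: private-key encryption ⇒ secure one-time signatures.** If there is
an efficient, correct private-key encryption scheme with indistinguishable multiple encryptions, then there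
is a secure one-time signature scheme for documents of arbitrary length: one-way functions exist by
Impagliazzo–Luby (`OWFExist_of_secureSKEExist_holds`), one-way functions give universal one-way hash
functions (Goldreich 2004, Thm. 6.4.29; proved in the tree along Haitner–Holenstein–Reingold–Vadhan–Wee,
`HHRVW.exists_isUOWHF_of_OWFExist`), and one-time hash-and-sign over Lamport's scheme is a secure one-time
signature scheme (Thm. 6.4.32) — packaged as `exists_isOneTimeSecure_of_OWFExist`.
[Impagliazzo–Luby 1989, Thm. 1; Goldreich 2004, Thm. 6.4.29 and Thm. 6.4.32]
[cite: ImpagliazzoLuby1989, Thm. 1] [cite: Goldreich2004, Thm. 6.4.32 with Thm. 6.4.29] -/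
theorem exists_isOneTimeSecure_of_secureSKEExist (h : SecureSKEExist) :
    ∃ S : SignatureScheme, S.IsOneTimeSecure :=
  exists_isOneTimeSecure_of_OWFExist (OWFExist_of_secureSKEExist_holds h)

/-- **The corollary reduced to Goldreich's Thm. 6.4.9 alone.** Given the step "secure one-time signature
schemes ⇒ secure (memoryless, EUF-CMA) signature schemes" (Goldreich 2004, Thm. 6.4.9: authentication trees,
Constructions 6.4.14/6.4.16), secure private-key encryption gives secure signature schemes — the remaining
hypothesis of `secureSignaturesExist_of_secureSKEExist_of_oneTimeSecure`, its `h₁` being now the theorem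
`exists_isOneTimeSecure_of_OWFExist`. [Goldreich 2004, Thm. 6.4.1, §6.4.3.4 and Thm. 6.4.9]
[cite: Goldreich2004, Thm. 6.4.1 and §6.4.3.4] -/
theorem secureSignaturesExist_of_secureSKEExist_of_thm649
    (h₂ : (∃ S : SignatureScheme, S.IsOneTimeSecure) → SecureSignaturesExist) :
    secureSignaturesExist_of_secureSKEExist :=
  secureSignaturesExist_of_secureSKEExist_of_OWF (secureSignaturesExist_of_OWFExist_of_thm649 h₂)

end Literature.Computability.Cryptography
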